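import Literature.AlgebraicGeometry.Motives.SegreEmbeddingPoints
import Literature.AlgebraicGeometry.Motives.ChowConeChow
import Literature.AlgebraicGeometry.Motives.ChowTheoremEquivalences
import Literature.NumberTheory.Transcendental.ProjectiveSpaceProofs
import Literature.NumberTheory.Transcendental.ProjectiveSpaceT2Proofs
import Literature.Geometry.Kaehler.AnalyticSet
import Literature.Geometry.Kaehler.AnalyticSetGraph
import Mathlib.Geometry.Manifold.MFDeriv.Atlas
import Mathlib.Geometry.Manifold.MFDeriv.SpecificFunctions
import Mathlib.Topology.Maps.OpenQuotient
import HarnessLib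

/-!
# The Segre map on projectivizations; Chow's theorem for `ℙⁿ(ℂ) × ℙᵐ(ℂ)`

Family `hodge` (**hodge.S17**, Chow / GAGA), layer `Literature/AlgebraicGeometry/Motives`, next to
`GAGA.lean` (Chow's theorem for `ℙᴺ(ℂ)`, projective form, discharged in `ChowConeChow.lean`) and to
`SegreEmbedding.lean` / `SegreEmbeddingPoints.lean` (the scheme-theoretic Segre embedding
`ℙⁿ_k ×ₖ ℙᵐ_k ⟶ ℙ^{nm+n+m}_k` and its effect `([z],[w]) ↦ [z ⊗ w]` on field-valued points).

This file is the **analytic** counterpart: the Segre map on Mathlib's projectivizations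
`ℙ 𝕜 (Fin (n+1) → 𝕜) × ℙ 𝕜 (Fin (m+1) → 𝕜) → ℙ 𝕜 (Fin (nm+n+m+1) → 𝕜)`, `([v],[w]) ↦ [v ⊗ w]`
with `(v ⊗ w)_{(a,b)} = v_a w_b` in the SAME enumeration `segreIndexEquiv n m` of the pairs `(a,b)`
as the scheme-side embedding, for the quotient topology and the standard affine atlases of
`Literature/NumberTheory/Transcendental/ProjectiveSpace.lean` (`Projectivization.stdChart`), and the
transport of complex-analytic subsets (`Literature.Geometry.Kaehler.IsAnalyticSet`,
`Geometry/Kaehler/AnalyticSet.lean`) along it. Purpose (LIT-FANOUT row D3 (c), "GAGA for maps",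
Mumford, *Algebraic Geometry I*, §4B (4.14): "let `Γ_f ⊂ X × Y` be its graph. By Chow's theorem,
`Γ_f` is a closed algebraic subset of `X × Y`"): Chow's theorem is stated and proved in the tree for
subsets of a single projective space `ℙᴺ(ℂ)`; to apply it to a graph one embeds `ℙⁿ × ℙᵐ` by Segre
and needs that closed analytic subsets of `ℙⁿ(ℂ) × ℙᵐ(ℂ)` go to closed analytic subsets of
`ℙ^{nm+n+m}(ℂ)`. That is the main theorem here; everything is PROVED (no named facts).

## Main definitions and results

* `segreProj` — the Segre map on projectivizations (any field); `segreProj_mk_mk` (value on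
  representatives), `segreProj_injective`, `segreProj_mem_stdChartSource_iff`
  (`[v ⊗ w] ∈ U_{(i,k)} ↔ [v] ∈ Uᵢ ∧ [w] ∈ U_k`).
* `segreColumn`, `segreRow`, `segreMinor` — over the chart `U_{(i,k)}` of the Segre space: the affine
  coordinates (charts `Uᵢ`, `U_k`) of the `k`-th column and `i`-th row of `[z]`, and the normalised
  `2 × 2` minors; `segreColumn_segreProj`, `segreRow_segreProj` (column/row of `[v ⊗ w]` are `[v]`,
  `[w]`), `segreMinor_segreProj` (the minors vanish on the image), `segreProj_stdChartInv_eq`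
  (conversely a point of `U_{(i,k)}` with vanishing minors is the Segre image of its column and row).
* `continuous_segreProj`, `isClosedEmbedding_segreProj` (proper `𝕜`: compact source, Hausdorff
  target), `isClosed_image_segreProj`.
* `mdifferentiableOn_rep_div_rep` — the normalised homogeneous coordinates `z_t / z_{t₀}` are
  holomorphic on `U_{t₀} ⊆ ℙᴺ(ℂ)`; `mdifferentiableOn_segreColumn/Row/Minor/Retract`;
  `mdifferentiable_segreProj` — the Segre map is holomorphic.
* `isAnalyticSet_image_segreProj` — **Segre images of (closed) analytic subsets of
  `ℙⁿ(ℂ) × ℙᵐ(ℂ)` are (closed) analytic subsets of `ℙ^{nm+n+m}(ℂ)`**; `isAnalyticSet_image_segreProj_iff`.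
* `isProjAlgebraicSet_image_segreProj`, `exists_eq_preimage_projZeroLocus_of_isAnalyticSet`,
  `isAnalyticSet_preimage_segreProj_projZeroLocus`, `isAnalyticSet_iff_exists_eq_preimage_projZeroLocus`
  — **Chow's theorem for `ℙⁿ(ℂ) × ℙᵐ(ℂ)`**: a subset is (closed) analytic iff it is cut out by
  finitely many homogeneous forms in the Segre coordinates `v ⊗ w` (bihomogeneous forms), by the
  tree's Chow theorem `isProjAlgebraicSet_of_isAnalyticSet_holds` (`ChowConeChow.lean`) and its
  converse `IsProjAlgebraicSet.isAnalyticSet_holds` (`ChowTheoremEquivalences.lean`);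
  `mk_mem_preimage_segreProj_projZeroLocus_iff` reads the equations on representatives.
* `segreMinorForm`, `segreMinorForms`, `range_segreProj_eq_projZeroLocus`,
  `isProjAlgebraicSet_range_segreProj` — **the Segre variety**: the image of the Segre map is the
  projective zero locus of the `2 × 2` minors `z_{(a,b)} z_{(i,k)} - z_{(a,k)} z_{(i,b)}` (any field).
* `isAnalyticSet_graph_projectivization`, `isProjAlgebraicSet_image_segreProj_graph`,
  `exists_finset_apply_mk_eq_mk_iff` — **Chow's theorem on the graph**: a holomorphic map
  `f : ℙⁿ(ℂ) → ℙᵐ(ℂ)` has an algebraic graph (`f [v] = [w] ↔ F(v ⊗ w) = 0` for finitely many forms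
  `F`), from the tree's graph lemma `Literature.Geometry.Kaehler.isAnalyticSet_graph`
  (`Geometry/Kaehler/AnalyticSetGraph.lean`) and the transport theorem.

## Proof of the transport theorem

Let `Z ⊆ ℙⁿ × ℙᵐ` be analytic (hence closed) and `y ∈ ℙ^{nm+n+m}`. If `y ∉ segreProj '' Z`, the
image being closed (compactness), `Z` is analytic at `y` with the equation `1 = 0`
(`IsAnalyticSetAt.of_notMem_closure`). If `y = segreProj (p, q)` with `p ∈ Uᵢ`, `q ∈ U_k`, then on
the chart `O = U_{(i,k)} ∋ y` the retraction `r : [z] ↦ (φᵢ⁻¹ (column k), φ_k⁻¹ (row i))` is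
holomorphic (`mdifferentiableOn_segreRetract`: its chart coordinates are quotients of homogeneous
coordinates), `r ∘ segreProj = id` on `Uᵢ × U_k`, and `segreProj ∘ r = id` on the common zero set of
the minors in `O`; so if `Z ∩ W = {g = 0}` near `(p, q)`, then on `U = O ∩ r⁻¹ W` the image
`segreProj '' Z` is the common zero set of the (holomorphic) minors and of `g ∘ r`
(`IsAnalyticSetAt.of_fintype`).

## References

* [Mumford1981] D. Mumford, *Algebraic Geometry I: Complex Projective Varieties*, Grundlehren 221
  (1981), §2B (Segre embedding), §4B (4.14) Corollary p. 67 (graphs, Chow).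
* [Hartshorne1977] R. Hartshorne, *Algebraic Geometry* (1977), I Ex. 2.14 (Segre embedding: image =
  zero set of the `2 × 2` minors, bijective onto it).
* [GriffithsHarris1978] P. Griffiths, J. Harris, *Principles of Algebraic Geometry* (1978), Ch. 0 §2
  p. 15 (charts of `ℙⁿ`), p. 166–167 (Chow's theorem).
* [GAGA1956] J.-P. Serre, *Géométrie algébrique et géométrie analytique*, Ann. Inst. Fourier 6
  (1956), §3 Prop. 13.
-/

noncomputable section

open scoped Manifold ContDiff Topology LinearAlgebra.Projectivization
open Set Function Topology Projectivization

namespace Literature.AlgebraicGeometry.Motives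

/-! ### The Segre map on projectivizations -/

section Algebra

variable {𝕜 : Type*} [Field 𝕜] {n m : ℕ}

/-- The **Segre map** `ℙⁿ(𝕜) × ℙᵐ(𝕜) → ℙ^{nm+n+m}(𝕜)`, `([v], [w]) ↦ [v ⊗ w]`, where
`(v ⊗ w)_{(a,b)} = v_a w_b` in the lexicographic enumeration `segreIndexEquiv n m` of the pairs
`(a, b)` (the same homogeneous coordinates as the scheme-theoretic Segre embedding
`segreEmbedding n m k`, cf. `ProjectiveSpace.map_segreEmbedding_lift_pointOfVec`). It is defined
through the chosen representatives `Projectivization.rep`; `segreProj_mk_mk` computes it on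
arbitrary representatives. [Hartshorne, *Algebraic Geometry*, I Ex. 2.14; Mumford, *Algebraic
Geometry I*, §2B] [cite: Hartshorne1977, I Ex. 2.14] -/
def segreProj (x : ℙ 𝕜 (Fin (n + 1) → 𝕜) × ℙ 𝕜 (Fin (m + 1) → 𝕜)) :
    ℙ 𝕜 (Fin (n * m + n + m + 1) → 𝕜) :=
  Projectivization.mk 𝕜
    (fun t => x.1.rep ((segreIndexEquiv n m).symm t).1 * x.2.rep ((segreIndexEquiv n m).symm t).2)
    (ProjectiveSpace.segreVec_ne_zero x.1.rep_nonzero x.2.rep_nonzero)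

/-- The Segre map on representatives: `segreProj ([v], [w]) = [v ⊗ w]`.
[cite: Hartshorne1977, I Ex. 2.14] -/
theorem segreProj_mk_mk (v : Fin (n + 1) → 𝕜) (hv : v ≠ 0) (w : Fin (m + 1) → 𝕜) (hw : w ≠ 0) :
    segreProj (Projectivization.mk 𝕜 v hv, Projectivization.mk 𝕜 w hw) =
      Projectivization.mk 𝕜
        (fun t => v ((segreIndexEquiv n m).symm t).1 * w ((segreIndexEquiv n m).symm t).2)
        (ProjectiveSpace.segreVec_ne_zero hv hw) := by
  obtain ⟨a, ha⟩ := exists_smul_eq_mk_rep 𝕜 v hv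
  obtain ⟨b, hb⟩ := exists_smul_eq_mk_rep 𝕜 w hw
  rw [segreProj, mk_eq_mk_iff]
  refine ⟨a * b, funext fun t => ?_⟩
  simp only [← ha, ← hb, Pi.smul_apply, Units.smul_def, smul_eq_mul, Units.val_mul]
  ring

/-- The Segre map is injective: `[v ⊗ w]` determines `[v]` and `[w]` (read off a row and a column
of the rank-one matrix `v ⊗ w`). [cite: Hartshorne1977, I Ex. 2.14] -/
theorem segreProj_injective :
    Injective (segreProj : ℙ 𝕜 (Fin (n + 1) → 𝕜) × ℙ 𝕜 (Fin (m + 1) → 𝕜) → _) := by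
  rintro ⟨p, q⟩ ⟨p', q'⟩ h
  induction p with | h v hv =>
  induction q with | h w hw =>
  induction p' with | h v' hv' =>
  induction q' with | h w' hw' =>
  rw [segreProj_mk_mk, segreProj_mk_mk, mk_eq_mk_iff] at h
  obtain ⟨c, hc⟩ := h
  have hc' : ∀ a b, (c : 𝕜) * (v' a * w' b) = v a * w b := fun a b => by
    have := congrFun hc (segreIndexEquiv n m (a, b))
    simpa [Units.smul_def] using this
  obtain ⟨a₀, ha₀⟩ := Function.ne_iff.mp hv
  obtain ⟨b₀, hb₀⟩ := Function.ne_iff.mp hw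
  replace ha₀ : v a₀ ≠ 0 := ha₀
  replace hb₀ : w b₀ ≠ 0 := hb₀
  have h₀ : (c : 𝕜) * (v' a₀ * w' b₀) ≠ 0 := by
    rw [hc']; exact mul_ne_zero ha₀ hb₀
  have hv'₀ : v' a₀ ≠ 0 := fun h => h₀ (by simp [h])
  have hw'₀ : w' b₀ ≠ 0 := fun h => h₀ (by simp [h])
  refine Prod.ext ((mk_eq_mk_iff' 𝕜 _ _ _ _).2 ⟨c * w' b₀ / w b₀, funext fun a => ?_⟩)
    ((mk_eq_mk_iff' 𝕜 _ _ _ _).2 ⟨c * v' a₀ / v a₀, funext fun b => ?_⟩)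
  · have := hc' a b₀
    simp only [Pi.smul_apply, smul_eq_mul]
    rw [div_mul_eq_mul_div, div_eq_iff hb₀]
    linear_combination this
  · have := hc' a₀ b
    simp only [Pi.smul_apply, smul_eq_mul]
    rw [div_mul_eq_mul_div, div_eq_iff ha₀]
    linear_combination this

/-- `segreProj ([v],[w])` lies in the standard chart `U_{(i,k)} = {z_{(i,k)} ≠ 0}` of the Segre
space iff `[v] ∈ Uᵢ` and `[w] ∈ U_k` (`(v ⊗ w)_{(i,k)} = vᵢ w_k`). [cite: Hartshorne1977, I Ex. 2.14]
[cite: Mumford1981, §2B] -/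
theorem segreProj_mem_stdChartSource_iff (x : ℙ 𝕜 (Fin (n + 1) → 𝕜) × ℙ 𝕜 (Fin (m + 1) → 𝕜))
    (i : Fin (n + 1)) (k : Fin (m + 1)) :
    segreProj x ∈ stdChartSource (segreIndexEquiv n m (i, k)) ↔
      x.1 ∈ stdChartSource i ∧ x.2 ∈ stdChartSource k := by
  rw [segreProj, mk_mem_stdChartSource_iff]
  simp only [Equiv.symm_apply_apply, mul_ne_zero_iff, stdChartSource, mem_setOf_eq]

/-! ### The affine retraction over a standard chart of the Segre space

Over the chart `U_{(i,k)} = {z_{(i,k)} ≠ 0}` of `ℙ^{nm+n+m}` the Segre map is inverted by reading off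
the `k`-th column `(z_{(a,k)})_a` and the `i`-th row `(z_{(i,b)})_b` of the matrix `z`; in the affine
coordinates of the charts `Uᵢ ⊆ ℙⁿ`, `U_k ⊆ ℙᵐ` these are the vectors `segreColumn i k [z]`,
`segreRow i k [z]` below, and `[z]` lies in the Segre image iff the normalised `2 × 2` minors
`segreMinor i a k b [z] = z_{(a,b)}/z_{(i,k)} - (z_{(a,k)}/z_{(i,k)})(z_{(i,b)}/z_{(i,k)})` vanish.
-/

/-- Affine coordinates (chart `Uᵢ` of `ℙⁿ`) of the `k`-th column of `[z] ∈ ℙ^{nm+n+m}`: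
`(z_{(i.succAbove j, k)} / z_{(i,k)})_j`. Meaningful on the chart `U_{(i,k)}`.
[cite: Mumford1981, §2B (Segre embedding)] -/
def segreColumn (i : Fin (n + 1)) (k : Fin (m + 1)) (y : ℙ 𝕜 (Fin (n * m + n + m + 1) → 𝕜)) :
    Fin n → 𝕜 :=
  fun j => y.rep (segreIndexEquiv n m (i.succAbove j, k)) / y.rep (segreIndexEquiv n m (i, k))

/-- Affine coordinates (chart `U_k` of `ℙᵐ`) of the `i`-th row of `[z] ∈ ℙ^{nm+n+m}`:
`(z_{(i, k.succAbove l)} / z_{(i,k)})_l`. Meaningful on the chart `U_{(i,k)}`.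
[cite: Mumford1981, §2B (Segre embedding)] -/
def segreRow (i : Fin (n + 1)) (k : Fin (m + 1)) (y : ℙ 𝕜 (Fin (n * m + n + m + 1) → 𝕜)) :
    Fin m → 𝕜 :=
  fun l => y.rep (segreIndexEquiv n m (i, k.succAbove l)) / y.rep (segreIndexEquiv n m (i, k))

/-- The normalised `2 × 2` minor `z_{(a,b)}/z_{(i,k)} - (z_{(a,k)}/z_{(i,k)}) (z_{(i,b)}/z_{(i,k)})` of
`[z] ∈ ℙ^{nm+n+m}` (a well-defined function on the chart `U_{(i,k)}`); the Segre variety is cut out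
on `U_{(i,k)}` by these minors. [cite: Hartshorne1977, I Ex. 2.14] -/
def segreMinor (i a : Fin (n + 1)) (k b : Fin (m + 1)) (y : ℙ 𝕜 (Fin (n * m + n + m + 1) → 𝕜)) :
    𝕜 :=
  y.rep (segreIndexEquiv n m (a, b)) / y.rep (segreIndexEquiv n m (i, k)) -
    y.rep (segreIndexEquiv n m (a, k)) / y.rep (segreIndexEquiv n m (i, k)) *
      (y.rep (segreIndexEquiv n m (i, b)) / y.rep (segreIndexEquiv n m (i, k)))

/-- A unit multiple of `v ⊗ w` represents `segreProj ([v], [w])` (with `v = p.rep`, `w = q.rep`);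
plumbing for the chosen representatives. [folklore] -/
private theorem exists_smul_eq_rep_segreProj (x : ℙ 𝕜 (Fin (n + 1) → 𝕜) × ℙ 𝕜 (Fin (m + 1) → 𝕜)) :
    ∃ c : 𝕜ˣ, (c • fun t => x.1.rep ((segreIndexEquiv n m).symm t).1 *
        x.2.rep ((segreIndexEquiv n m).symm t).2) = (segreProj x).rep :=
  exists_smul_eq_mk_rep 𝕜 _ _

/-- On `ℙⁿ × U_k` the column coordinates of the Segre image are the affine coordinates of the first
factor: `segreColumn i k (segreProj (p, q)) = φᵢ(p)`. [cite: Mumford1981, §2B] -/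
theorem segreColumn_segreProj (p : ℙ 𝕜 (Fin (n + 1) → 𝕜)) {q : ℙ 𝕜 (Fin (m + 1) → 𝕜)}
    (i : Fin (n + 1)) {k : Fin (m + 1)} (hq : q ∈ stdChartSource k) :
    segreColumn i k (segreProj (p, q)) = stdChartFun i p := by
  obtain ⟨c, hc⟩ := exists_smul_eq_rep_segreProj (p, q)
  have hqk : q.rep k ≠ 0 := hq
  funext j
  simp only [segreColumn, ← hc, Pi.smul_apply, Units.smul_def, smul_eq_mul,
    Equiv.symm_apply_apply, stdChartFun]
  rw [mul_div_mul_left _ _ c.ne_zero, mul_div_mul_right _ _ hqk]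

/-- On `Uᵢ × ℙᵐ` the row coordinates of the Segre image are the affine coordinates of the second
factor: `segreRow i k (segreProj (p, q)) = φ_k(q)`. [cite: Mumford1981, §2B] -/
theorem segreRow_segreProj {p : ℙ 𝕜 (Fin (n + 1) → 𝕜)} (q : ℙ 𝕜 (Fin (m + 1) → 𝕜))
    {i : Fin (n + 1)} (k : Fin (m + 1)) (hp : p ∈ stdChartSource i) :
    segreRow i k (segreProj (p, q)) = stdChartFun k q := by
  obtain ⟨c, hc⟩ := exists_smul_eq_rep_segreProj (p, q)
  have hpi : p.rep i ≠ 0 := hp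
  funext l
  simp only [segreRow, ← hc, Pi.smul_apply, Units.smul_def, smul_eq_mul,
    Equiv.symm_apply_apply, stdChartFun]
  rw [mul_div_mul_left _ _ c.ne_zero, mul_comm (p.rep i) (q.rep k), mul_comm (p.rep i) (q.rep _),
    mul_div_mul_right _ _ hpi]

/-- The normalised minors vanish on the Segre image (`v ⊗ w` has rank one). [cite: Hartshorne1977, I Ex. 2.14] -/
theorem segreMinor_segreProj (i a : Fin (n + 1)) (k b : Fin (m + 1))
    (x : ℙ 𝕜 (Fin (n + 1) → 𝕜) × ℙ 𝕜 (Fin (m + 1) → 𝕜)) : segreMinor i a k b (segreProj x) = 0 := by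
  obtain ⟨c, hc⟩ := exists_smul_eq_rep_segreProj x
  simp only [segreMinor, ← hc, Pi.smul_apply, Units.smul_def, smul_eq_mul, Equiv.symm_apply_apply]
  rw [mul_div_mul_left _ _ c.ne_zero, mul_div_mul_left _ _ c.ne_zero,
    mul_div_mul_left _ _ c.ne_zero]
  by_cases h : x.1.rep i * x.2.rep k = 0
  · simp [h]
  · rw [sub_eq_zero, div_mul_div_comm, div_eq_div_iff h (mul_ne_zero h h)]
    ring

/-- **The Segre map is inverted over `U_{(i,k)}` by column and row.** If `[z] ∈ U_{(i,k)}` and all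
normalised minors `segreMinor i a k b [z]` vanish, then `[z]` is the Segre image of the pair of points
with affine coordinates `segreColumn i k [z]`, `segreRow i k [z]`. [cite: Hartshorne1977, I Ex. 2.14] -/
theorem segreProj_stdChartInv_eq {i : Fin (n + 1)} {k : Fin (m + 1)}
    {y : ℙ 𝕜 (Fin (n * m + n + m + 1) → 𝕜)} (hy : y ∈ stdChartSource (segreIndexEquiv n m (i, k)))
    (hmin : ∀ a b, segreMinor i a k b y = 0) :
    segreProj (stdChartInv i (segreColumn i k y), stdChartInv k (segreRow i k y)) = y := by
  induction y with | h z hz =>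
  have hik : z (segreIndexEquiv n m (i, k)) ≠ 0 := (mk_mem_stdChartSource_iff _ _ _).1 hy
  obtain ⟨c, hc⟩ := exists_smul_eq_mk_rep 𝕜 z hz
  have hcol : (Fin.insertNth i (1 : 𝕜) (segreColumn i k (Projectivization.mk 𝕜 z hz)) :
      Fin (n + 1) → 𝕜) = fun a => z (segreIndexEquiv n m (a, k)) / z (segreIndexEquiv n m (i, k)) := by
    funext a
    refine Fin.succAboveCases i ?_ (fun j => ?_) a
    · rw [Fin.insertNth_apply_same, div_self hik]
    · rw [Fin.insertNth_apply_succAbove]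
      simp only [segreColumn, ← hc, Pi.smul_apply, Units.smul_def, smul_eq_mul]
      rw [mul_div_mul_left _ _ c.ne_zero]
  have hrow : (Fin.insertNth k (1 : 𝕜) (segreRow i k (Projectivization.mk 𝕜 z hz)) :
      Fin (m + 1) → 𝕜) = fun b => z (segreIndexEquiv n m (i, b)) / z (segreIndexEquiv n m (i, k)) := by
    funext b
    refine Fin.succAboveCases k ?_ (fun l => ?_) b
    · rw [Fin.insertNth_apply_same, div_self hik]
    · rw [Fin.insertNth_apply_succAbove]
      simp only [segreRow, ← hc, Pi.smul_apply, Units.smul_def, smul_eq_mul]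
      rw [mul_div_mul_left _ _ c.ne_zero]
  rw [stdChartInv, stdChartInv, segreProj_mk_mk, mk_eq_mk_iff']
  refine ⟨(z (segreIndexEquiv n m (i, k)))⁻¹, funext fun t => ?_⟩
  obtain ⟨⟨a, b⟩, rfl⟩ := (segreIndexEquiv n m).surjective t
  rw [hcol, hrow]
  simp only [Equiv.symm_apply_apply, Pi.smul_apply, smul_eq_mul]
  have h := hmin a b
  simp only [segreMinor, ← hc, Pi.smul_apply, Units.smul_def, smul_eq_mul] at h
  rw [mul_div_mul_left _ _ c.ne_zero, mul_div_mul_left _ _ c.ne_zero,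
    mul_div_mul_left _ _ c.ne_zero, sub_eq_zero] at h
  rw [inv_mul_eq_div, h]

end Algebra

/-! ### Topology: continuity, closed embedding -/

section Topology

variable {𝕜 : Type*} [NontriviallyNormedField 𝕜] {n m : ℕ}

/-- The Segre map is continuous (the projections `𝕜ᵏ⁺¹ ∖ 0 → ℙᵏ(𝕜)` are open quotient maps, and
`(v, w) ↦ v ⊗ w` is continuous). [cite: Mumford1981, §2B] -/
theorem continuous_segreProj :
    Continuous (segreProj : ℙ 𝕜 (Fin (n + 1) → 𝕜) × ℙ 𝕜 (Fin (m + 1) → 𝕜) → _) := by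
  have hq := (isOpenQuotientMap_mk (𝕜 := 𝕜) (W := Fin (n + 1) → 𝕜)).prodMap
    (isOpenQuotientMap_mk (𝕜 := 𝕜) (W := Fin (m + 1) → 𝕜))
  refine hq.continuous_comp_iff.1 ?_
  have heq : (segreProj ∘ Prod.map (fun v : {v : Fin (n + 1) → 𝕜 // v ≠ 0} => Projectivization.mk 𝕜 v.1 v.2)
      (fun w : {w : Fin (m + 1) → 𝕜 // w ≠ 0} => Projectivization.mk 𝕜 w.1 w.2)) =
      fun vw => Projectivization.mk 𝕜
        (fun t => vw.1.1 ((segreIndexEquiv n m).symm t).1 * vw.2.1 ((segreIndexEquiv n m).symm t).2)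
        (ProjectiveSpace.segreVec_ne_zero vw.1.2 vw.2.2) := by
    funext vw
    exact segreProj_mk_mk _ _ _ _
  rw [heq]
  have hc : Continuous fun vw : {v : Fin (n + 1) → 𝕜 // v ≠ 0} × {w : Fin (m + 1) → 𝕜 // w ≠ 0} =>
      (⟨fun t => vw.1.1 ((segreIndexEquiv n m).symm t).1 * vw.2.1 ((segreIndexEquiv n m).symm t).2,
        ProjectiveSpace.segreVec_ne_zero vw.1.2 vw.2.2⟩ :
        {u : Fin (n * m + n + m + 1) → 𝕜 // u ≠ 0}) := by
    refine Continuous.subtype_mk (continuous_pi fun t => ?_) _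
    exact ((continuous_apply _).comp (continuous_subtype_val.comp continuous_fst)).mul
      ((continuous_apply _).comp (continuous_subtype_val.comp continuous_snd))
  exact continuous_mk.comp hc

/-- Over a proper field (e.g. `ℂ`) the Segre map is a closed embedding: it is a continuous injection
from the compact space `ℙⁿ × ℙᵐ` to the Hausdorff space `ℙ^{nm+n+m}`.
[cite: Hartshorne1977, I Ex. 2.14; Mumford1981, §2B] -/
theorem isClosedEmbedding_segreProj [ProperSpace 𝕜] :
    IsClosedEmbedding (segreProj : ℙ 𝕜 (Fin (n + 1) → 𝕜) × ℙ 𝕜 (Fin (m + 1) → 𝕜) → _) := by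
  haveI : CompactSpace (ℙ 𝕜 (Fin (n + 1) → 𝕜)) := compactSpace_of_properSpace
  haveI : CompactSpace (ℙ 𝕜 (Fin (m + 1) → 𝕜)) := compactSpace_of_properSpace
  haveI : T2Space (ℙ 𝕜 (Fin (n * m + n + m + 1) → 𝕜)) := t2Space_pi
  exact continuous_segreProj.isClosedEmbedding segreProj_injective

/-- The Segre image of a closed subset of `ℙⁿ × ℙᵐ` is closed (proper field): the Segre map is a
closed embedding. [cite: Hartshorne1977, I Ex. 2.14] [cite: Mumford1981, §2B] -/
theorem isClosed_image_segreProj [ProperSpace 𝕜]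
    {Z : Set (ℙ 𝕜 (Fin (n + 1) → 𝕜) × ℙ 𝕜 (Fin (m + 1) → 𝕜))} (hZ : IsClosed Z) :
    IsClosed (segreProj '' Z) :=
  isClosedEmbedding_segreProj.isClosedMap Z hZ

end Topology

/-! ### Holomorphy (over `ℂ`) -/

section Analytic

open Literature.Geometry.Kaehler Literature.NumberTheory.Transcendental

variable {n m : ℕ}

/-- The normalised homogeneous coordinate `[z] ↦ z_t / z_{t₀}` is holomorphic on the standard chart
`U_{t₀} = {z_{t₀} ≠ 0}` of `ℙᴺ(ℂ)` (it is a coordinate of the chart `φ_{t₀}`, or the constant `1`).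
[cite: GriffithsHarris1978, Ch. 0 §2 p. 15] -/
theorem mdifferentiableOn_rep_div_rep {N : ℕ} (t t₀ : Fin (N + 1)) :
    MDifferentiableOn 𝓘(ℂ, Fin N → ℂ) 𝓘(ℂ, ℂ)
      (fun p : ℙ ℂ (Fin (N + 1) → ℂ) => p.rep t / p.rep t₀) (stdChartSource t₀) := by
  haveI : IsManifold 𝓘(ℂ, Fin N → ℂ) ω (ℙ ℂ (Fin (N + 1) → ℂ)) :=
    isManifold_projectivization_holds ℂ N
  rcases eq_or_ne t t₀ with rfl | ht
  · exact mdifferentiableOn_const.congr_mono (fun p hp => div_self hp) subset_rfl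
  · obtain ⟨s, rfl⟩ := Fin.exists_succAbove_eq ht
    have hmem : stdChart t₀ ∈ atlas (Fin N → ℂ) (ℙ ℂ (Fin (N + 1) → ℂ)) := ⟨t₀, rfl⟩
    have h := mdifferentiableOn_atlas (I := 𝓘(ℂ, Fin N → ℂ)) hmem
    exact ((mdifferentiableOn_pi_space (I := 𝓘(ℂ, Fin N → ℂ)) (F := fun _ : Fin N => ℂ)).1 h s)

/-- The column coordinates `segreColumn i k` are holomorphic on `U_{(i,k)}` (quotients of
homogeneous coordinates by `z_{(i,k)}`). [cite: GriffithsHarris1978, Ch. 0 §2 p. 15] -/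
theorem mdifferentiableOn_segreColumn (i : Fin (n + 1)) (k : Fin (m + 1)) :
    MDifferentiableOn 𝓘(ℂ, Fin (n * m + n + m) → ℂ) 𝓘(ℂ, Fin n → ℂ)
      (segreColumn (𝕜 := ℂ) i k) (stdChartSource (segreIndexEquiv n m (i, k))) :=
  (mdifferentiableOn_pi_space (I := 𝓘(ℂ, Fin (n * m + n + m) → ℂ)) (F := fun _ : Fin n => ℂ)).2
    fun _ => mdifferentiableOn_rep_div_rep _ _

/-- The row coordinates `segreRow i k` are holomorphic on `U_{(i,k)}` (quotients of homogeneous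
coordinates by `z_{(i,k)}`). [cite: GriffithsHarris1978, Ch. 0 §2 p. 15] -/
theorem mdifferentiableOn_segreRow (i : Fin (n + 1)) (k : Fin (m + 1)) :
    MDifferentiableOn 𝓘(ℂ, Fin (n * m + n + m) → ℂ) 𝓘(ℂ, Fin m → ℂ)
      (segreRow (𝕜 := ℂ) i k) (stdChartSource (segreIndexEquiv n m (i, k))) :=
  (mdifferentiableOn_pi_space (I := 𝓘(ℂ, Fin (n * m + n + m) → ℂ)) (F := fun _ : Fin m => ℂ)).2
    fun _ => mdifferentiableOn_rep_div_rep _ _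

/-- The normalised minors `segreMinor i a k b` are holomorphic on `U_{(i,k)}` (polynomials in the
affine coordinates of the chart `U_{(i,k)}`). [cite: GriffithsHarris1978, Ch. 0 §2 p. 15]
[cite: Hartshorne1977, I Ex. 2.14] -/
theorem mdifferentiableOn_segreMinor (i a : Fin (n + 1)) (k b : Fin (m + 1)) :
    MDifferentiableOn 𝓘(ℂ, Fin (n * m + n + m) → ℂ) 𝓘(ℂ, ℂ)
      (segreMinor (𝕜 := ℂ) i a k b) (stdChartSource (segreIndexEquiv n m (i, k))) :=
  (mdifferentiableOn_rep_div_rep _ _).sub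
    ((mdifferentiableOn_rep_div_rep _ _).mul (mdifferentiableOn_rep_div_rep _ _))

/-- The affine retraction `U_{(i,k)} → Uᵢ × U_k ⊆ ℙⁿ × ℙᵐ`, `[z] ↦ ([column k], [row i])`, is
holomorphic. [cite: Mumford1981, §2B] -/
theorem mdifferentiableOn_segreRetract (i : Fin (n + 1)) (k : Fin (m + 1)) :
    MDifferentiableOn 𝓘(ℂ, Fin (n * m + n + m) → ℂ) ((𝓘(ℂ, Fin n → ℂ)).prod (𝓘(ℂ, Fin m → ℂ)))
      (fun y : ℙ ℂ (Fin (n * m + n + m + 1) → ℂ) =>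
        ((stdChart i).symm (segreColumn i k y), (stdChart k).symm (segreRow i k y)))
      (stdChartSource (segreIndexEquiv n m (i, k))) := by
  haveI : IsManifold 𝓘(ℂ, Fin n → ℂ) ω (ℙ ℂ (Fin (n + 1) → ℂ)) :=
    isManifold_projectivization_holds ℂ n
  haveI : IsManifold 𝓘(ℂ, Fin m → ℂ) ω (ℙ ℂ (Fin (m + 1) → ℂ)) :=
    isManifold_projectivization_holds ℂ m
  have h₁ : MDifferentiableOn 𝓘(ℂ, Fin n → ℂ) 𝓘(ℂ, Fin n → ℂ)
      (stdChart (𝕜 := ℂ) i).symm (stdChart (𝕜 := ℂ) i).target :=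
    mdifferentiableOn_atlas_symm (I := 𝓘(ℂ, Fin n → ℂ)) ⟨i, rfl⟩
  have h₂ : MDifferentiableOn 𝓘(ℂ, Fin m → ℂ) 𝓘(ℂ, Fin m → ℂ)
      (stdChart (𝕜 := ℂ) k).symm (stdChart (𝕜 := ℂ) k).target :=
    mdifferentiableOn_atlas_symm (I := 𝓘(ℂ, Fin m → ℂ)) ⟨k, rfl⟩
  exact (h₁.comp (mdifferentiableOn_segreColumn i k) fun _ _ => mem_univ _).prodMk
    (h₂.comp (mdifferentiableOn_segreRow i k) fun _ _ => mem_univ _)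

/-! ### Transport of analytic subsets along the Segre map; Chow's theorem for `ℙⁿ × ℙᵐ` -/

/-- **Segre images of analytic sets are analytic.** If `Z ⊆ ℙⁿ(ℂ) × ℙᵐ(ℂ)` is a (closed) analytic
subset for the product of the standard holomorphic atlases, then its Segre image is a (closed)
analytic subset of `ℙ^{nm+n+m}(ℂ)`: near a point `segreProj (p, q)` with `p ∈ Uᵢ`, `q ∈ U_k` it is
cut out, on `U_{(i,k)}`, by the normalised `2 × 2` minors together with the local equations of `Z`
pulled back along the holomorphic retraction `[z] ↦ ([column k], [row i])`; near a point off the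
(closed) image by `1 = 0`. [cite: Mumford1981, §4B (4.14) (proof: "Γ_f ⊂ X × Y … by Chow's theorem
Γ_f is a closed algebraic subset")] [cite: GriffithsHarris1978, p. 167] -/
theorem isAnalyticSet_image_segreProj {Z : Set (ℙ ℂ (Fin (n + 1) → ℂ) × ℙ ℂ (Fin (m + 1) → ℂ))}
    (hZ : IsAnalyticSet ((𝓘(ℂ, Fin n → ℂ)).prod (𝓘(ℂ, Fin m → ℂ))) Z) :
    IsAnalyticSet 𝓘(ℂ, Fin (n * m + n + m) → ℂ) (segreProj '' Z) := by
  have hcl : IsClosed (segreProj '' Z) := isClosed_image_segreProj hZ.isClosed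
  intro y
  by_cases hy : y ∈ segreProj '' Z
  swap
  · exact IsAnalyticSetAt.of_notMem_closure (by rwa [hcl.closure_eq])
  obtain ⟨⟨p, q⟩, hxZ, rfl⟩ := hy
  obtain ⟨i, hi⟩ := exists_rep_apply_ne_zero p
  obtain ⟨k, hk⟩ := exists_rep_apply_ne_zero q
  replace hi : p ∈ stdChartSource i := hi
  replace hk : q ∈ stdChartSource k := hk
  obtain ⟨W, hW, hxW, a, g, hg, hgZ⟩ := (hZ (p, q)).exists_forall
  set O : Set (ℙ ℂ (Fin (n * m + n + m + 1) → ℂ)) := stdChartSource (segreIndexEquiv n m (i, k))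
    with hO
  set r : ℙ ℂ (Fin (n * m + n + m + 1) → ℂ) → ℙ ℂ (Fin (n + 1) → ℂ) × ℙ ℂ (Fin (m + 1) → ℂ) :=
    fun y => ((stdChart i).symm (segreColumn i k y), (stdChart k).symm (segreRow i k y)) with hr_def
  have hr : MDifferentiableOn 𝓘(ℂ, Fin (n * m + n + m) → ℂ)
      ((𝓘(ℂ, Fin n → ℂ)).prod (𝓘(ℂ, Fin m → ℂ))) r O := mdifferentiableOn_segreRetract i k
  have hr_segre : ∀ (p' : ℙ ℂ (Fin (n + 1) → ℂ)) (q' : ℙ ℂ (Fin (m + 1) → ℂ)),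
      p' ∈ stdChartSource i → q' ∈ stdChartSource k → r (segreProj (p', q')) = (p', q') := by
    intro p' q' hp' hq'
    simp only [hr_def, segreColumn_segreProj p' i hq', segreRow_segreProj q' k hp',
      stdChart_symm_apply, stdChartInv_stdChartFun i hp', stdChartInv_stdChartFun k hq']
  set U := O ∩ r ⁻¹' W with hU_def
  have hU : IsOpen U := hr.continuousOn.isOpen_inter_preimage (isOpen_stdChartSource _) hW
  have hyO : segreProj (p, q) ∈ O := (segreProj_mem_stdChartSource_iff _ i k).2 ⟨hi, hk⟩
  have hyU : segreProj (p, q) ∈ U := ⟨hyO, by rw [mem_preimage, hr_segre p q hi hk]; exact hxW⟩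
  refine IsAnalyticSetAt.of_fintype (ι := (Fin (n + 1) × Fin (m + 1)) ⊕ Fin a) hU hyU
    (fun y => Sum.elim (fun ab => segreMinor i ab.1 k ab.2 y) (fun c => g (r y) c)) ?_ ?_
  · rintro (⟨a', b'⟩ | c)
    · exact (mdifferentiableOn_segreMinor i a' k b').mono inter_subset_left
    · exact (hg c).comp (hr.mono inter_subset_left) fun y hy => hy.2
  · ext y
    simp only [mem_inter_iff, mem_image, mem_setOf_eq, Sum.forall, Sum.elim_inl, Sum.elim_inr,
      Prod.exists]
    constructor
    · rintro ⟨⟨p', q', hZ', rfl⟩, hyU'⟩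
      have hO' := (segreProj_mem_stdChartSource_iff _ i k).1 hyU'.1
      have hrW : r (segreProj (p', q')) ∈ W := hyU'.2
      rw [hr_segre p' q' hO'.1 hO'.2] at hrW
      refine ⟨hyU', fun ab => segreMinor_segreProj _ _ _ _ _, fun c => ?_⟩
      rw [hr_segre p' q' hO'.1 hO'.2]
      exact ((hgZ (p', q') hrW).1 hZ') c
    · rintro ⟨hyU', hmin, hgr⟩
      refine ⟨⟨(r y).1, (r y).2, (hgZ (r y) hyU'.2).2 hgr, ?_⟩, hyU'⟩
      exact segreProj_stdChartInv_eq hyU'.1 fun a' b' => hmin (a', b')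

/-- **Chow's theorem for `ℙⁿ(ℂ) × ℙᵐ(ℂ)`, Segre form.** The Segre image of a (closed) analytic subset
of `ℙⁿ(ℂ) × ℙᵐ(ℂ)` is a projective algebraic subset of `ℙ^{nm+n+m}(ℂ)` — by
`isAnalyticSet_image_segreProj` and Chow's theorem for `ℙᴺ(ℂ)`
(`isProjAlgebraicSet_of_isAnalyticSet_holds`, `ChowConeChow.lean`).
[cite: Mumford1981, §4B (4.14)] [cite: GAGA1956, §3 Prop. 13] -/
theorem isProjAlgebraicSet_image_segreProj
    {Z : Set (ℙ ℂ (Fin (n + 1) → ℂ) × ℙ ℂ (Fin (m + 1) → ℂ))}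
    (hZ : IsAnalyticSet ((𝓘(ℂ, Fin n → ℂ)).prod (𝓘(ℂ, Fin m → ℂ))) Z) :
    IsProjAlgebraicSet (segreProj '' Z) :=
  isProjAlgebraicSet_of_isAnalyticSet_holds (isClosed_image_segreProj hZ.isClosed)
    (isAnalyticSet_image_segreProj hZ)

/-- **Chow's theorem for `ℙⁿ(ℂ) × ℙᵐ(ℂ)`, bihomogeneous form.** A (closed) analytic subset `Z` of
`ℙⁿ(ℂ) × ℙᵐ(ℂ)` is algebraic: there are finitely many homogeneous forms `F` in the `(n+1)(m+1)`
Segre coordinates `z_{(a,b)}` such that `Z = {([v],[w]) | F(v ⊗ w) = 0 for all F}`, i.e. `Z` is cut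
out by the bihomogeneous polynomials `F(x ⊗ y)`. [cite: Mumford1981, §4B (4.14)]
[cite: GAGA1956, §3 Prop. 13] -/
theorem exists_eq_preimage_projZeroLocus_of_isAnalyticSet
    {Z : Set (ℙ ℂ (Fin (n + 1) → ℂ) × ℙ ℂ (Fin (m + 1) → ℂ))}
    (hZ : IsAnalyticSet ((𝓘(ℂ, Fin n → ℂ)).prod (𝓘(ℂ, Fin m → ℂ))) Z) :
    ∃ S : Finset (MvPolynomial (Fin (n * m + n + m + 1)) ℂ),
      (∀ F ∈ S, F.IsHomogeneous F.totalDegree) ∧ Z = segreProj ⁻¹' projZeroLocus (↑S) := by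
  obtain ⟨S, hS, hSZ⟩ := isProjAlgebraicSet_image_segreProj hZ
  exact ⟨S, hS, by rw [← hSZ, preimage_image_eq Z segreProj_injective]⟩

/-- Membership in the pull-back of a projective zero locus along the Segre map, on representatives:
`([v],[w]) ∈ segreProj⁻¹ V(S) ↔ F(v ⊗ w) = 0` for all `F ∈ S` (`S` homogeneous) — the dictionary
between forms on the Segre space and bihomogeneous equations on `ℙⁿ × ℙᵐ`.
[cite: Hartshorne1977, I Ex. 2.14, II Ex. 5.11] -/
theorem mk_mem_preimage_segreProj_projZeroLocus_iff {𝕜 : Type*} [Field 𝕜]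
    {S : Set (MvPolynomial (Fin (n * m + n + m + 1)) 𝕜)}
    (hS : ∀ F ∈ S, F.IsHomogeneous F.totalDegree) (v : Fin (n + 1) → 𝕜) (hv : v ≠ 0)
    (w : Fin (m + 1) → 𝕜) (hw : w ≠ 0) :
    (Projectivization.mk 𝕜 v hv, Projectivization.mk 𝕜 w hw) ∈ segreProj ⁻¹' projZeroLocus S ↔
      ∀ F ∈ S, MvPolynomial.eval
        (fun t => v ((segreIndexEquiv n m).symm t).1 * w ((segreIndexEquiv n m).symm t).2) F = 0 := by
  rw [mem_preimage, segreProj_mk_mk, mem_projZeroLocus_mk_iff hS]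

/-! ### The Segre map is holomorphic; analytic = algebraic for subsets of `ℙⁿ(ℂ) × ℙᵐ(ℂ)` -/

/-- **The Segre map is holomorphic** (for the product of the standard atlases of `ℙⁿ(ℂ)`, `ℙᵐ(ℂ)`
and the standard atlas of `ℙ^{nm+n+m}(ℂ)`): on `Uᵢ × U_k` its affine coordinates in the chart
`U_{(i,k)}` are the products `(v_a / v_i)(w_b / w_k)`. [cite: Mumford1981, §2B]
[cite: GriffithsHarris1978, Ch. 0 §2 p. 15] -/
theorem mdifferentiable_segreProj :
    MDifferentiable ((𝓘(ℂ, Fin n → ℂ)).prod (𝓘(ℂ, Fin m → ℂ))) 𝓘(ℂ, Fin (n * m + n + m) → ℂ)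
      (segreProj : ℙ ℂ (Fin (n + 1) → ℂ) × ℙ ℂ (Fin (m + 1) → ℂ) → _) := by
  haveI : IsManifold 𝓘(ℂ, Fin (n * m + n + m) → ℂ) ω (ℙ ℂ (Fin (n * m + n + m + 1) → ℂ)) :=
    isManifold_projectivization_holds ℂ _
  rintro ⟨p, q⟩
  obtain ⟨i, hi⟩ := exists_rep_apply_ne_zero p
  obtain ⟨k, hk⟩ := exists_rep_apply_ne_zero q
  replace hi : p ∈ stdChartSource i := hi
  replace hk : q ∈ stdChartSource k := hk
  set Φ : ℙ ℂ (Fin (n + 1) → ℂ) × ℙ ℂ (Fin (m + 1) → ℂ) → (Fin (n * m + n + m) → ℂ) :=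
    fun x s => x.1.rep ((segreIndexEquiv n m).symm ((segreIndexEquiv n m (i, k)).succAbove s)).1 /
        x.1.rep i *
      (x.2.rep ((segreIndexEquiv n m).symm ((segreIndexEquiv n m (i, k)).succAbove s)).2 /
        x.2.rep k) with hΦ
  set V : Set (ℙ ℂ (Fin (n + 1) → ℂ) × ℙ ℂ (Fin (m + 1) → ℂ)) :=
    stdChartSource i ×ˢ stdChartSource k with hV
  have hVo : IsOpen V := (isOpen_stdChartSource i).prod (isOpen_stdChartSource k)
  have hxV : (p, q) ∈ V := ⟨hi, hk⟩
  have hΦd : MDifferentiableOn ((𝓘(ℂ, Fin n → ℂ)).prod (𝓘(ℂ, Fin m → ℂ)))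
      𝓘(ℂ, Fin (n * m + n + m) → ℂ) Φ V := by
    refine (mdifferentiableOn_pi_space (F := fun _ : Fin (n * m + n + m) => ℂ)).2 fun s => ?_
    exact ((mdifferentiableOn_rep_div_rep _ i).comp mdifferentiableOn_fst fun x hx => hx.1).mul
      ((mdifferentiableOn_rep_div_rep _ k).comp mdifferentiableOn_snd fun x hx => hx.2)
  have hsymm : MDifferentiableOn 𝓘(ℂ, Fin (n * m + n + m) → ℂ) 𝓘(ℂ, Fin (n * m + n + m) → ℂ)
      (stdChart (𝕜 := ℂ) (segreIndexEquiv n m (i, k))).symm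
      (stdChart (𝕜 := ℂ) (segreIndexEquiv n m (i, k))).target :=
    mdifferentiableOn_atlas_symm (I := 𝓘(ℂ, Fin (n * m + n + m) → ℂ)) ⟨_, rfl⟩
  have hcomp := hsymm.comp hΦd fun _ _ => mem_univ _
  have heq : ∀ x ∈ V, segreProj x =
      ((stdChart (𝕜 := ℂ) (segreIndexEquiv n m (i, k))).symm ∘ Φ) x := by
    rintro ⟨p', q'⟩ ⟨hp', hq'⟩
    have hmem : segreProj (p', q') ∈ stdChartSource (segreIndexEquiv n m (i, k)) :=
      (segreProj_mem_stdChartSource_iff _ i k).2 ⟨hp', hq'⟩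
    rw [comp_apply, stdChart_symm_apply, ← stdChartInv_stdChartFun _ hmem]
    congr 1
    obtain ⟨c, hc⟩ := exists_smul_eq_rep_segreProj (p', q')
    funext s
    simp only [stdChartFun, hΦ, ← hc, Pi.smul_apply, Units.smul_def, smul_eq_mul,
      Equiv.symm_apply_apply]
    rw [mul_div_mul_left _ _ c.ne_zero, mul_div_mul_comm]
  exact (hcomp.congr_mono heq subset_rfl).mdifferentiableAt (hVo.mem_nhds hxV)

/-- Analyticity transports both ways along the Segre map: `segreProj '' Z` is an analytic subset of
`ℙ^{nm+n+m}(ℂ)` iff `Z` is an analytic subset of `ℙⁿ(ℂ) × ℙᵐ(ℂ)` (`⇐`: `isAnalyticSet_image_segreProj`;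
`⇒`: pull back along the holomorphic injection `segreProj`). [cite: Mumford1981, §4B] -/
theorem isAnalyticSet_image_segreProj_iff
    {Z : Set (ℙ ℂ (Fin (n + 1) → ℂ) × ℙ ℂ (Fin (m + 1) → ℂ))} :
    IsAnalyticSet 𝓘(ℂ, Fin (n * m + n + m) → ℂ) (segreProj '' Z) ↔
      IsAnalyticSet ((𝓘(ℂ, Fin n → ℂ)).prod (𝓘(ℂ, Fin m → ℂ))) Z := by
  refine ⟨fun h => ?_, isAnalyticSet_image_segreProj⟩
  rw [← preimage_image_eq Z segreProj_injective]
  exact h.preimage mdifferentiable_segreProj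

/-- **Algebraic ⇒ analytic on `ℙⁿ(ℂ) × ℙᵐ(ℂ)`:** the common zero set of finitely many homogeneous forms
in the Segre coordinates `v ⊗ w` is an analytic subset of `ℙⁿ(ℂ) × ℙᵐ(ℂ)` (pull back the analytic set
`V(S) ⊆ ℙ^{nm+n+m}(ℂ)`, `IsProjAlgebraicSet.isAnalyticSet_holds`, along the holomorphic Segre map).
[cite: GriffithsHarris1978, p. 166] -/
theorem isAnalyticSet_preimage_segreProj_projZeroLocus
    (S : Finset (MvPolynomial (Fin (n * m + n + m + 1)) ℂ))
    (hS : ∀ F ∈ S, F.IsHomogeneous F.totalDegree) :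
    IsAnalyticSet ((𝓘(ℂ, Fin n → ℂ)).prod (𝓘(ℂ, Fin m → ℂ)))
      (segreProj ⁻¹' projZeroLocus (↑S : Set (MvPolynomial (Fin (n * m + n + m + 1)) ℂ))) :=
  (IsProjAlgebraicSet.isAnalyticSet_holds ⟨S, hS, rfl⟩).preimage mdifferentiable_segreProj

/-- **Chow's theorem for `ℙⁿ(ℂ) × ℙᵐ(ℂ)` (analytic = algebraic).** A subset `Z ⊆ ℙⁿ(ℂ) × ℙᵐ(ℂ)` is a
(closed) analytic subset for the product of the standard holomorphic atlases iff it is the common zero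
set of finitely many homogeneous forms in the Segre coordinates `v ⊗ w` (equivalently, of finitely
many bihomogeneous forms of equal bidegree). [cite: Mumford1981, §4B (4.14)]
[cite: GAGA1956, §3 Prop. 13] -/
theorem isAnalyticSet_iff_exists_eq_preimage_projZeroLocus
    {Z : Set (ℙ ℂ (Fin (n + 1) → ℂ) × ℙ ℂ (Fin (m + 1) → ℂ))} :
    IsAnalyticSet ((𝓘(ℂ, Fin n → ℂ)).prod (𝓘(ℂ, Fin m → ℂ))) Z ↔
      ∃ S : Finset (MvPolynomial (Fin (n * m + n + m + 1)) ℂ),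
        (∀ F ∈ S, F.IsHomogeneous F.totalDegree) ∧ Z = segreProj ⁻¹' projZeroLocus (↑S) := by
  refine ⟨exists_eq_preimage_projZeroLocus_of_isAnalyticSet, ?_⟩
  rintro ⟨S, hS, rfl⟩
  exact isAnalyticSet_preimage_segreProj_projZeroLocus S hS

end Analytic

/-! ### The Segre variety: the image of the Segre map is cut out by the `2 × 2` minors -/

section SegreVariety

open Literature.NumberTheory.Transcendental

variable {𝕜 : Type*} [Field 𝕜] {n m : ℕ}

/-- The `2 × 2` minor `z_{(a,b)} z_{(i,k)} - z_{(a,k)} z_{(i,b)}` of the generic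
`(n+1) × (m+1)` matrix, as a homogeneous quadratic form in the Segre coordinates.
[cite: Hartshorne1977, I Ex. 2.14] -/
def segreMinorForm (i a : Fin (n + 1)) (k b : Fin (m + 1)) :
    MvPolynomial (Fin (n * m + n + m + 1)) 𝕜 :=
  MvPolynomial.X (segreIndexEquiv n m (a, b)) * MvPolynomial.X (segreIndexEquiv n m (i, k)) -
    MvPolynomial.X (segreIndexEquiv n m (a, k)) * MvPolynomial.X (segreIndexEquiv n m (i, b))

/-- Evaluation of the minor form: `z_{(a,b)} z_{(i,k)} - z_{(a,k)} z_{(i,b)}`.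
[cite: Hartshorne1977, I Ex. 2.14] -/
@[simp]
theorem eval_segreMinorForm (i a : Fin (n + 1)) (k b : Fin (m + 1))
    (z : Fin (n * m + n + m + 1) → 𝕜) :
    MvPolynomial.eval z (segreMinorForm i a k b) =
      z (segreIndexEquiv n m (a, b)) * z (segreIndexEquiv n m (i, k)) -
        z (segreIndexEquiv n m (a, k)) * z (segreIndexEquiv n m (i, b)) := by
  simp [segreMinorForm]

/-- The minor forms are homogeneous (of degree `2 = totalDegree`, or `0` when the form vanishes,
e.g. for `a = i`). [cite: Hartshorne1977, I Ex. 2.14] -/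
theorem isHomogeneous_segreMinorForm (i a : Fin (n + 1)) (k b : Fin (m + 1)) :
    (segreMinorForm (𝕜 := 𝕜) i a k b).IsHomogeneous (segreMinorForm (𝕜 := 𝕜) i a k b).totalDegree := by
  refine isHomogeneous_totalDegree_of_exists ⟨2, ?_⟩
  exact ((MvPolynomial.isHomogeneous_X 𝕜 _).mul (MvPolynomial.isHomogeneous_X 𝕜 _)).sub
    ((MvPolynomial.isHomogeneous_X 𝕜 _).mul (MvPolynomial.isHomogeneous_X 𝕜 _))

/-- The finite set of all `2 × 2` minor forms of the generic `(n+1) × (m+1)` matrix (the equations of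
the Segre variety). [cite: Hartshorne1977, I Ex. 2.14] -/
def segreMinorForms (𝕜 : Type*) [Field 𝕜] (n m : ℕ) :
    Finset (MvPolynomial (Fin (n * m + n + m + 1)) 𝕜) :=
  (Set.finite_range fun q : (Fin (n + 1) × Fin (n + 1)) × (Fin (m + 1) × Fin (m + 1)) =>
    (segreMinorForm q.1.1 q.1.2 q.2.1 q.2.2 : MvPolynomial (Fin (n * m + n + m + 1)) 𝕜)).toFinset

/-- Membership in `segreMinorForms`: the minor forms, indexed by `((i, a), (k, b))`.
[cite: Hartshorne1977, I Ex. 2.14] -/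
theorem mem_segreMinorForms_iff {F : MvPolynomial (Fin (n * m + n + m + 1)) 𝕜} :
    F ∈ segreMinorForms 𝕜 n m ↔ ∃ i a k b, segreMinorForm i a k b = F := by
  rw [segreMinorForms, Set.Finite.mem_toFinset, Set.mem_range]
  constructor
  · rintro ⟨⟨⟨i, a⟩, ⟨k, b⟩⟩, rfl⟩
    exact ⟨i, a, k, b, rfl⟩
  · rintro ⟨i, a, k, b, rfl⟩
    exact ⟨((i, a), (k, b)), rfl⟩

/-- Every element of `segreMinorForms` is homogeneous of its total degree. [cite: Hartshorne1977, I Ex. 2.14] -/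
theorem isHomogeneous_of_mem_segreMinorForms {F : MvPolynomial (Fin (n * m + n + m + 1)) 𝕜}
    (hF : F ∈ segreMinorForms 𝕜 n m) : F.IsHomogeneous F.totalDegree := by
  obtain ⟨i, a, k, b, rfl⟩ := mem_segreMinorForms_iff.1 hF
  exact isHomogeneous_segreMinorForm _ _ _ _

/-- A vector `z` annihilated by all minor forms has all `2 × 2` minors zero. [folklore] -/
private theorem minors_eq_of_forall_mem_segreMinorForms {z : Fin (n * m + n + m + 1) → 𝕜}
    (hz : ∀ F ∈ segreMinorForms 𝕜 n m, MvPolynomial.eval z F = 0)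
    (i a : Fin (n + 1)) (k b : Fin (m + 1)) :
    z (segreIndexEquiv n m (a, b)) * z (segreIndexEquiv n m (i, k)) =
      z (segreIndexEquiv n m (a, k)) * z (segreIndexEquiv n m (i, b)) := by
  have h := hz (segreMinorForm i a k b) (mem_segreMinorForms_iff.2 ⟨i, a, k, b, rfl⟩)
  rwa [eval_segreMinorForm, sub_eq_zero] at h

/-- **The Segre variety.** The image of the Segre map `ℙⁿ × ℙᵐ → ℙ^{nm+n+m}` is exactly the
projective zero locus of the `2 × 2` minors `z_{(a,b)} z_{(i,k)} - z_{(a,k)} z_{(i,b)}`: a matrix of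
rank one is a product `v ⊗ w` of a nonzero column and a nonzero row. [cite: Hartshorne1977, I Ex. 2.14] -/
theorem range_segreProj_eq_projZeroLocus :
    range (segreProj : ℙ 𝕜 (Fin (n + 1) → 𝕜) × ℙ 𝕜 (Fin (m + 1) → 𝕜) → _) =
      projZeroLocus (↑(segreMinorForms 𝕜 n m) : Set (MvPolynomial (Fin (n * m + n + m + 1)) 𝕜)) := by
  have hS : ∀ F ∈ (↑(segreMinorForms 𝕜 n m) : Set (MvPolynomial (Fin (n * m + n + m + 1)) 𝕜)),
      F.IsHomogeneous F.totalDegree := fun F hF => isHomogeneous_of_mem_segreMinorForms hF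
  apply Subset.antisymm
  · rintro _ ⟨⟨p, q⟩, rfl⟩
    induction p with | h v hv =>
    induction q with | h w hw =>
    rw [segreProj_mk_mk, mem_projZeroLocus_mk_iff hS]
    intro F hF
    obtain ⟨i, a, k, b, rfl⟩ := mem_segreMinorForms_iff.1 hF
    simp only [eval_segreMinorForm, Equiv.symm_apply_apply]
    ring
  · intro y hy
    induction y with | h z hz =>
    rw [mem_projZeroLocus_mk_iff hS] at hy
    obtain ⟨t₀, ht₀⟩ := Function.ne_iff.1 hz
    obtain ⟨⟨i, k⟩, rfl⟩ := (segreIndexEquiv n m).surjective t₀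
    replace ht₀ : z (segreIndexEquiv n m (i, k)) ≠ 0 := ht₀
    have hmem : Projectivization.mk 𝕜 z hz ∈ stdChartSource (segreIndexEquiv n m (i, k)) :=
      (mk_mem_stdChartSource_iff _ _ _).2 ht₀
    refine ⟨(stdChartInv i (segreColumn i k (Projectivization.mk 𝕜 z hz)),
      stdChartInv k (segreRow i k (Projectivization.mk 𝕜 z hz))),
      segreProj_stdChartInv_eq hmem fun a b => ?_⟩
    -- the normalised minors vanish since the homogeneous ones do
    obtain ⟨c, hc⟩ := exists_smul_eq_mk_rep 𝕜 z hz
    simp only [segreMinor, ← hc, Pi.smul_apply, Units.smul_def, smul_eq_mul]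
    rw [mul_div_mul_left _ _ c.ne_zero, mul_div_mul_left _ _ c.ne_zero,
      mul_div_mul_left _ _ c.ne_zero, sub_eq_zero, div_mul_div_comm,
      div_eq_div_iff ht₀ (mul_ne_zero ht₀ ht₀)]
    have := minors_eq_of_forall_mem_segreMinorForms hy i a k b
    linear_combination z (segreIndexEquiv n m (i, k)) * this

/-- The image of the Segre map (the Segre variety) is a projective algebraic subset of `ℙ^{nm+n+m}`,
cut out by the `2 × 2` minors. [cite: Hartshorne1977, I Ex. 2.14] -/
theorem isProjAlgebraicSet_range_segreProj :
    IsProjAlgebraicSet (range (segreProj : ℙ 𝕜 (Fin (n + 1) → 𝕜) × ℙ 𝕜 (Fin (m + 1) → 𝕜) → _)) :=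
  ⟨segreMinorForms 𝕜 n m, fun _ hF => isHomogeneous_of_mem_segreMinorForms hF,
    range_segreProj_eq_projZeroLocus⟩

end SegreVariety

/-! ### Graphs of holomorphic maps `ℙⁿ(ℂ) → ℙᵐ(ℂ)` are algebraic (Chow's theorem on the graph) -/

section Graph

open Literature.Geometry.Kaehler Literature.NumberTheory.Transcendental

variable {n m : ℕ}

/-- **The graph of a holomorphic map `ℙⁿ(ℂ) → ℙᵐ(ℂ)` is an analytic subset of `ℙⁿ(ℂ) × ℙᵐ(ℂ)`**
(the tree's `Literature.Geometry.Kaehler.isAnalyticSet_graph` for the standard atlases; `ℙᵐ(ℂ)` is a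
Hausdorff complex manifold, `t2Space_projectivization_holds`, `isManifold_projectivization_holds`).
[cite: Mumford1981, §4B (4.14) Corollary, p. 67] -/
theorem isAnalyticSet_graph_projectivization
    {f : ℙ ℂ (Fin (n + 1) → ℂ) → ℙ ℂ (Fin (m + 1) → ℂ)}
    (hf : MDifferentiable 𝓘(ℂ, Fin n → ℂ) 𝓘(ℂ, Fin m → ℂ) f) :
    IsAnalyticSet ((𝓘(ℂ, Fin n → ℂ)).prod (𝓘(ℂ, Fin m → ℂ)))
      {p : ℙ ℂ (Fin (n + 1) → ℂ) × ℙ ℂ (Fin (m + 1) → ℂ) | f p.1 = p.2} := by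
  haveI : IsManifold 𝓘(ℂ, Fin m → ℂ) ω (ℙ ℂ (Fin (m + 1) → ℂ)) :=
    isManifold_projectivization_holds ℂ m
  haveI : T2Space (ℙ ℂ (Fin (m + 1) → ℂ)) := t2Space_projectivization_holds ℂ m
  exact isAnalyticSet_graph hf

/-- **Chow's theorem on the graph** (Mumford (4.14), first step: "let `Γ_f ⊂ X × Y` be its graph. By
Chow's theorem, `Γ_f` is a closed algebraic subset of `X × Y`", here for `X = ℙⁿ`, `Y = ℙᵐ`): the
Segre image of the graph of a holomorphic map `f : ℙⁿ(ℂ) → ℙᵐ(ℂ)` is a projective algebraic subset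
of `ℙ^{nm+n+m}(ℂ)`. [cite: Mumford1981, §4B (4.14) Corollary, p. 67]
[cite: Arapura2012, §15.4 Cor. 15.4.6] -/
theorem isProjAlgebraicSet_image_segreProj_graph
    {f : ℙ ℂ (Fin (n + 1) → ℂ) → ℙ ℂ (Fin (m + 1) → ℂ)}
    (hf : MDifferentiable 𝓘(ℂ, Fin n → ℂ) 𝓘(ℂ, Fin m → ℂ) f) :
    IsProjAlgebraicSet
      (segreProj '' {p : ℙ ℂ (Fin (n + 1) → ℂ) × ℙ ℂ (Fin (m + 1) → ℂ) | f p.1 = p.2}) :=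
  isProjAlgebraicSet_image_segreProj (isAnalyticSet_graph_projectivization hf)

/-- **Holomorphic maps `ℙⁿ(ℂ) → ℙᵐ(ℂ)` have algebraic graphs**: there are finitely many homogeneous
forms `F` in the Segre coordinates such that, for all nonzero `v ∈ ℂⁿ⁺¹`, `w ∈ ℂᵐ⁺¹`,
`f [v] = [w] ↔ F(v ⊗ w) = 0` for every `F` — the graph is cut out by bihomogeneous polynomials.
[cite: Mumford1981, §4B (4.14) Corollary, p. 67] [cite: GAGA1956, §3 Prop. 13] -/
theorem exists_finset_apply_mk_eq_mk_iff
    {f : ℙ ℂ (Fin (n + 1) → ℂ) → ℙ ℂ (Fin (m + 1) → ℂ)}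
    (hf : MDifferentiable 𝓘(ℂ, Fin n → ℂ) 𝓘(ℂ, Fin m → ℂ) f) :
    ∃ S : Finset (MvPolynomial (Fin (n * m + n + m + 1)) ℂ),
      (∀ F ∈ S, F.IsHomogeneous F.totalDegree) ∧
        ∀ (v : Fin (n + 1) → ℂ) (hv : v ≠ 0) (w : Fin (m + 1) → ℂ) (hw : w ≠ 0),
          f (Projectivization.mk ℂ v hv) = Projectivization.mk ℂ w hw ↔
            ∀ F ∈ S, MvPolynomial.eval
              (fun t => v ((segreIndexEquiv n m).symm t).1 * w ((segreIndexEquiv n m).symm t).2)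
                F = 0 := by
  obtain ⟨S, hS, hZ⟩ :=
    exists_eq_preimage_projZeroLocus_of_isAnalyticSet (isAnalyticSet_graph_projectivization hf)
  refine ⟨S, hS, fun v hv w hw => ?_⟩
  have key := mk_mem_preimage_segreProj_projZeroLocus_iff hS v hv w hw
  rw [← hZ] at key
  simpa only [Finset.mem_coe, mem_setOf_eq] using key

end Graph

end Literature.AlgebraicGeometry.Motives

end
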